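import Summits.AtomisticToContinuum.BoseEinsteinCondensation.Theses.BECModePrice
import Literature.MathematicalPhysics.QuantumManyBody.PeriodicBoseGasFracEnergy
import Literature.MathematicalPhysics.QuantumManyBody.BoseGasThermodynamicLimitRuelle
import Literature.Barriers.AtomisticToContinuum.KineticGapLengthScalesThermodynamicWindow
import Summits.AtomisticToContinuum.BoseEinsteinCondensation.Theorems.BECFeynmanVortexAreaBornRepresentativesExist

/-!
# Crux `ModePriceHardCore` (stmt-AtomisticToContinuum-18513) — ideator k5 g18 sketch

Kernel data for triage r2 of the crux idea `iso-scattering-price-transfer` (k5 g3/g8):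

* `halfModeEnergy`, `PriceTransfer` — re-typed verbatim from `Cruxes/ModePriceHardCore/Ideas/
  iso-scattering-price-transfer.md` (the card's residue: "the hard-core HALF-softened infimum is within
  `Cρ` of the integrable one at equal scattering length", in cross-multiplied additive `ℝ≥0∞` form).
* `priceTransfer_of_modePriceHardCore` — NEW: the residue is a CONSEQUENCE of the crux (take for `Φ` a
  `δ`-near-minimiser of `E_w`; the softening bonus `h_p(Φ) ≥ 0` is simply dropped). The hypotheses
  `∫ w ≠ ⊤` and `a(w) = a(v)` are NOT used: equal scattering length is logically inessential at the
  typed level (budget `Cρ`).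
* `modePriceHardCore_of_priceTransfer` — the card's direction, re-proved here so that the file certifies
  the exact re-coordinatisation
  `ModePriceIntegrable ∧ ModePriceHardCore ↔ ModePriceIntegrable ∧ PriceTransfer`
  (`modePrice_pair_iff`).
-/

noncomputable section

open Filter MeasureTheory Metric
open scoped ENNReal

namespace Summit.AtomisticToContinuum.BoseEinsteinCondensation.Cruxes.ModePriceHardCore.IdeatorK5g18

open Literature.MathematicalPhysics.QuantumManyBody.BoseGas
open Summit.AtomisticToContinuum.BoseEinsteinCondensation.Theses.BECModePrice

/-- The crux's own softening term `½ |2πp/L_N|² n_p(Ψ)` on the torus of side `L_N(ρ)`. [folklore] -/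
def halfModeEnergy (ρ : ℝ) (N : ℕ) (p : Fin 3 → ℤ)
    (Ψ : PeriodicTrialState N (sideLength ρ N)) : ℝ≥0∞ :=
  2⁻¹ * fracDispersion 2 (sideLength ρ N) p *
    cellOccupation N (sideLength ρ N) (planeWaveMode (sideLength ρ N) p) Ψ.ψ

/-- `PriceTransfer` (verbatim from the k5-g3 card): for admissible `v` non-integrable and `w` integrable
with `a(w) = a(v)`, the half-softened `v`-infimum is within `Cρ (+δ)` of the half-softened `w`-infimum,
written additively with a finite-energy `w`-competitor `Φ`. [conjecture: crux idea iso-scattering] -/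
def PriceTransfer : Prop :=
  ∀ v w : ℝ → ℝ≥0∞, IsRepulsiveFiniteRange v → IsRepulsiveFiniteRange w →
    (∫⁻ x : EuclideanSpace ℝ (Fin 3), v ‖x‖) = ⊤ → (∫⁻ x : EuclideanSpace ℝ (Fin 3), w ‖x‖) ≠ ⊤ →
    scatteringLength w = scatteringLength v →
    ∃ C : ℝ, 0 < C ∧ ∃ ρ₀ : ℝ, 0 < ρ₀ ∧ ∀ ρ : ℝ, 0 < ρ → ρ < ρ₀ → ∀ᶠ N : ℕ in Filter.atTop,
      ∀ p : Fin 3 → ℤ, p ≠ 0 → ∀ Ψ : PeriodicTrialState N (sideLength ρ N), ∀ δ : ℝ, 0 < δ →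
        ∃ Φ : PeriodicTrialState N (sideLength ρ N), periodicEnergy w Φ ≠ ⊤ ∧
          periodicGroundStateEnergy v N (sideLength ρ N) + halfModeEnergy ρ N p Ψ + periodicEnergy w Φ
            ≤ periodicEnergy v Ψ + periodicGroundStateEnergy w N (sideLength ρ N)
              + halfModeEnergy ρ N p Φ + ENNReal.ofReal (C * ρ + δ)

/-- The crux, unfolded into the `halfModeEnergy` notation (definitional). [folklore] -/
theorem modePriceHardCore_iff :
    ModePriceHardCore ↔
      ∀ v : ℝ → ℝ≥0∞, IsRepulsiveFiniteRange v → (∫⁻ x : EuclideanSpace ℝ (Fin 3), v ‖x‖) = ⊤ →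
        ∃ C : ℝ, 0 < C ∧ ∃ ρ₀ : ℝ, 0 < ρ₀ ∧ ∀ ρ : ℝ, 0 < ρ → ρ < ρ₀ → ∀ᶠ N : ℕ in atTop,
          ∀ p : Fin 3 → ℤ, p ≠ 0 → ∀ Ψ : PeriodicTrialState N (sideLength ρ N),
            periodicGroundStateEnergy v N (sideLength ρ N) + halfModeEnergy ρ N p Ψ
              ≤ periodicEnergy v Ψ + ENNReal.ofReal (C * ρ) :=
  Iff.rfl

/-- A `δ`-near-minimiser of finite energy exists as soon as the ground-state energy is finite.
[folklore] -/
theorem exists_nearMinimiser {w : ℝ → ℝ≥0∞} {N : ℕ} {L : ℝ}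
    (hfin : periodicGroundStateEnergy w N L < ⊤) {δ : ℝ} (hδ : 0 < δ) :
    ∃ Φ : PeriodicTrialState N L, periodicEnergy w Φ ≠ ⊤ ∧
      periodicEnergy w Φ ≤ periodicGroundStateEnergy w N L + ENNReal.ofReal δ := by
  have hlt : periodicGroundStateEnergy w N L < periodicGroundStateEnergy w N L + ENNReal.ofReal δ :=
    ENNReal.lt_add_right hfin.ne (by simpa using hδ)
  unfold periodicGroundStateEnergy at hlt ⊢
  obtain ⟨Φ, hΦ⟩ := iInf_lt_iff.1 hlt
  exact ⟨Φ, ne_top_of_lt hΦ, hΦ.le⟩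

/-- **NEW (g18): the iso-scattering residue is necessary.** `ModePriceHardCore → PriceTransfer`:
with `Φ` a `δ`-near-minimiser of `E_w` (finite by Ruelle finiteness at small density, eventually in
`N`) and `h_p(Φ) ≥ 0` dropped. Neither `∫ w ≠ ⊤` nor `a(w) = a(v)` is used. [folklore] -/
theorem priceTransfer_of_modePriceHardCore (h : ModePriceHardCore) : PriceTransfer := by
  intro v w hv hw hvtop _hwint _hsc
  obtain ⟨C, hC, ρ₀, hρ₀, hmp⟩ := h v hv hvtop
  obtain ⟨ρ₁, hρ₁, hfin⟩ :=
    Literature.Barriers.AtomisticToContinuum.BoseGas.exists_eventually_periodicGroundStateEnergy_lt_top hw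
  refine ⟨C, hC, min ρ₀ ρ₁, lt_min hρ₀ hρ₁, fun ρ hρ hρlt => ?_⟩
  have h₀ := hmp ρ hρ (hρlt.trans_le (min_le_left _ _))
  have h₁ := hfin ρ hρ (hρlt.trans_le (min_le_right _ _))
  filter_upwards [h₀, h₁] with N hN hfinN
  intro p hp Ψ δ hδ
  obtain ⟨Φ, hΦtop, hΦ⟩ := exists_nearMinimiser hfinN hδ
  refine ⟨Φ, hΦtop, ?_⟩
  have hN' : periodicGroundStateEnergy v N (sideLength ρ N) + halfModeEnergy ρ N p Ψ
      ≤ periodicEnergy v Ψ + ENNReal.ofReal (C * ρ) := hN p hp Ψ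
  calc periodicGroundStateEnergy v N (sideLength ρ N) + halfModeEnergy ρ N p Ψ + periodicEnergy w Φ
      ≤ (periodicEnergy v Ψ + ENNReal.ofReal (C * ρ))
          + (periodicGroundStateEnergy w N (sideLength ρ N) + ENNReal.ofReal δ) := add_le_add hN' hΦ
    _ = periodicEnergy v Ψ + periodicGroundStateEnergy w N (sideLength ρ N)
          + ENNReal.ofReal (C * ρ + δ) := by
        rw [ENNReal.ofReal_add (by positivity) hδ.le]; ring
    _ ≤ periodicEnergy v Ψ + periodicGroundStateEnergy w N (sideLength ρ N)
          + halfModeEnergy ρ N p Φ + ENNReal.ofReal (C * ρ + δ) :=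
        add_le_add le_self_add le_rfl

/-- A bounded finite-range radial profile is integrable on `ℝ³`. [folklore] -/
theorem lintegral_ne_top_of_bounded_finiteRange {w : ℝ → ℝ≥0∞} {M : NNReal} (hM : ∀ r, w r ≤ M)
    {R : ℝ} (hR0 : ∀ r, R < r → w r = 0) :
    (∫⁻ x : EuclideanSpace ℝ (Fin 3), w ‖x‖) ≠ ⊤ := by
  have hpt : ∀ x : EuclideanSpace ℝ (Fin 3),
      w ‖x‖ = (closedBall (0 : EuclideanSpace ℝ (Fin 3)) R).indicator (fun x => w ‖x‖) x := by
    intro x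
    by_cases hx : x ∈ closedBall (0 : EuclideanSpace ℝ (Fin 3)) R
    · rw [Set.indicator_of_mem hx]
    · rw [Set.indicator_of_notMem hx]
      apply hR0
      rw [mem_closedBall, dist_zero_right, not_le] at hx
      exact hx
  refine ne_top_of_lt (?_ : _ < ⊤)
  calc (∫⁻ x : EuclideanSpace ℝ (Fin 3), w ‖x‖)
      = ∫⁻ x, (closedBall (0 : EuclideanSpace ℝ (Fin 3)) R).indicator (fun x => w ‖x‖) x :=
        lintegral_congr hpt
    _ = ∫⁻ x in closedBall (0 : EuclideanSpace ℝ (Fin 3)) R, w ‖x‖ :=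
        lintegral_indicator measurableSet_closedBall _
    _ ≤ ∫⁻ _x in closedBall (0 : EuclideanSpace ℝ (Fin 3)) R, (M : ℝ≥0∞) :=
        lintegral_mono fun x => hM ‖x‖
    _ = (M : ℝ≥0∞) * volume (closedBall (0 : EuclideanSpace ℝ (Fin 3)) R) := setLIntegral_const _ _
    _ < ⊤ := ENNReal.mul_lt_top ENNReal.coe_lt_top measure_closedBall_lt_top

/-- The k5-g3 card's direction, re-proved: integrable SMS for the Born representative of `a(v)` plus
`PriceTransfer` give the hard-core crux (cancel the finite `E_w(Φ)`, then let `δ → 0`).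
[conjecture: crux idea iso-scattering] -/
theorem modePriceHardCore_of_priceTransfer (hMI : ModePriceIntegrable) (hPT : PriceTransfer) :
    ModePriceHardCore := by
  intro v hv hvtop
  obtain ⟨R, _hR, hvR⟩ := hv.exists_pos_range
  have hatop : scatteringLength v ≠ ⊤ := scatteringLength_ne_top_of_finiteRange hvR
  obtain ⟨w, hw, ⟨M, hM⟩, ⟨Rw, _hRw, hw0, _⟩, hsc⟩ :=
    Theorems.exists_bornRepresentative one_pos (ENNReal.toReal_nonneg : 0 ≤ (scatteringLength v).toReal)
  rw [ENNReal.ofReal_toReal hatop] at hsc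
  have hwint := lintegral_ne_top_of_bounded_finiteRange hM hw0
  obtain ⟨C₁, hC₁, ρ₁, hρ₁, hI⟩ := hMI w hw hwint
  obtain ⟨C₂, hC₂, ρ₂, hρ₂, hT⟩ := hPT v w hv hw hvtop hwint hsc
  refine ⟨C₁ + C₂, by positivity, min ρ₁ ρ₂, lt_min hρ₁ hρ₂, fun ρ hρ hρlt => ?_⟩
  have h₁ := hI ρ hρ (hρlt.trans_le (min_le_left _ _))
  have h₂ := hT ρ hρ (hρlt.trans_le (min_le_right _ _))
  filter_upwards [h₁, h₂] with N hIN hTN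
  intro p hp Ψ
  show periodicGroundStateEnergy v N (sideLength ρ N) + halfModeEnergy ρ N p Ψ
      ≤ periodicEnergy v Ψ + ENNReal.ofReal ((C₁ + C₂) * ρ)
  refine ENNReal.le_of_forall_pos_le_add fun δ hδ _ => ?_
  have hδ' : (0 : ℝ) < δ := NNReal.coe_pos.2 hδ
  obtain ⟨Φ, hΦtop, hΦ⟩ := hTN p hp Ψ δ hδ'
  have hIΦ : periodicGroundStateEnergy w N (sideLength ρ N) + halfModeEnergy ρ N p Φ
      ≤ periodicEnergy w Φ + ENNReal.ofReal (C₁ * ρ) := hIN p hp Φ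
  -- add the two inequalities and cancel the finite `E_w(Φ)`
  have hsum : periodicGroundStateEnergy v N (sideLength ρ N) + halfModeEnergy ρ N p Ψ
        + periodicEnergy w Φ
      ≤ periodicEnergy v Ψ + ENNReal.ofReal ((C₁ + C₂) * ρ) + δ + periodicEnergy w Φ := by
    calc periodicGroundStateEnergy v N (sideLength ρ N) + halfModeEnergy ρ N p Ψ + periodicEnergy w Φ
        ≤ periodicEnergy v Ψ + periodicGroundStateEnergy w N (sideLength ρ N)
            + halfModeEnergy ρ N p Φ + ENNReal.ofReal (C₂ * ρ + δ) := hΦ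
      _ = periodicEnergy v Ψ + ENNReal.ofReal (C₂ * ρ + δ)
            + (periodicGroundStateEnergy w N (sideLength ρ N) + halfModeEnergy ρ N p Φ) := by ring
      _ ≤ periodicEnergy v Ψ + ENNReal.ofReal (C₂ * ρ + δ)
            + (periodicEnergy w Φ + ENNReal.ofReal (C₁ * ρ)) := add_le_add le_rfl hIΦ
      _ = periodicEnergy v Ψ + ENNReal.ofReal ((C₁ + C₂) * ρ) + δ + periodicEnergy w Φ := by
          rw [ENNReal.ofReal_add (by positivity) hδ'.le, ENNReal.ofReal_coe_nnreal,
            show (C₁ + C₂) * ρ = C₁ * ρ + C₂ * ρ by ring,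
            ENNReal.ofReal_add (by positivity) (by positivity)]
          ring
  exact (ENNReal.add_le_add_iff_right hΦtop).1 hsum

/-- **Exact re-coordinatisation of the route's two price cruxes** (g18): modulo the sibling crux
`ModePriceIntegrable` (stmt-18512), the hard-core crux and the iso-scattering residue are EQUIVALENT.
[folklore] -/
theorem modePrice_pair_iff :
    (ModePriceIntegrable ∧ ModePriceHardCore) ↔ (ModePriceIntegrable ∧ PriceTransfer) :=
  ⟨fun h => ⟨h.1, priceTransfer_of_modePriceHardCore h.2⟩,
    fun h => ⟨h.1, modePriceHardCore_of_priceTransfer h.1 h.2⟩⟩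

end Summit.AtomisticToContinuum.BoseEinsteinCondensation.Cruxes.ModePriceHardCore.IdeatorK5g18

end
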